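import Mathlib
import Summits.CriticalPhenomena.SAWScalingLimit.Theorems.SAWDevelopingMapNoFoldBoundWalledWalks
import Summits.CriticalPhenomena.SAWScalingLimit.Theorems.SAWDevelopingMapNoFoldBoundPortRenewalWalks

/-!
# Port renewal of the SAW parafermionic observable at a vertex off the source

Helper file for the crux `NoFoldBound` (stmt-CriticalPhenomena-8296) of the route
`SAWDevelopingMap` (sub-problem `SAWScalingLimit` of `CriticalPhenomena`), line `Ideator3Sketch`:
it proves the stub `stub_portRenewal` of that line.

Setting (Duminil-Copin–Smirnov 2012, §2): a finite vertex set `Λ` of the hexagonal lattice `ℍ`,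
a source mid-edge `a`, a vertex `v ∈ Λ` with `v ∉ a` and its three neighbours `w₀, w₁, w₂`; write
`F_Λ(a; z) = Σ_{ω ⊂ Λ : a → z} e^{-iσ W(ω)} x^{ℓ(ω)}` (`hexParafermionicObservable`).  A first
arrival at `v` through the port `w_j` is a walk `γ : a → {v, w_j}` avoiding `v`.

**Renewal at the first visit to `v`.**  Every walk `ω : a → {v, w₀}` of `Λ` either avoids `v` —
then it is a first arrival through `w₀` followed by the trivial walk of the slit domain
`Λ ∖ ω` at the mid-edge `{w₀, v} = {v, w₀}` — or visits `v`, entering it from a unique port `w_j`;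
cutting there (`PortRenewal.exists_cut`) gives a first arrival `γ` through `w_j` and a walk of
the slit domain `Λ ∖ γ` from the door `{w_j, v}` to `{v, w₀}`, and gluing (`PortRenewal.glue_*`)
is the inverse, with multiplicative weights (`PortRenewal.weight_eq_of_verts_eq_append`).
Hence, for all real `x, σ` and without any simple-connectivity assumption,

  `F_Λ(a; {v,w₀}) = Σ_{j=0,1,2} Σ_{γ first arrival via w_j} weight(γ) · F_{Λ∖γ}({w_j,v}; {v,w₀})`.

* `PortRenewal.port_sum` — the `j`-th summand equals the sum of the weights of the walks
  `ω : a → {v, w₀}` that avoid `v` with `w_j = w₀` or pass `w_j` right before `v`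
  (`Fintype.sum_bijective` for the gluing map on the sigma type of pairs `(γ, η)`,
  `WalledPorts.sum_subtype_eq_sum_ite` of the walled-vertex file);
* `PortRenewal.eq_ite_add_ite_add_ite` — these three classes partition the walks `a → {v, w₀}`;
* **`stub_portRenewal`** — the identity above.
-/

noncomputable section

open scoped BigOperators
open Literature.Probability.LatticeModels Literature.Probability.RandomPlanarGeometry.SAW

namespace Summit.CriticalPhenomena.SAWScalingLimit.Theorems.SAWDevelopingMapNoFoldBound

namespace PortRenewal

variable {Λ : Finset HexVertex} {a : Sym2 HexVertex} {v w w₀ w₁ w₂ : HexVertex}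

/-- **The port sum.** For `v ∈ Λ` off `a` and neighbours `w, w₀` of `v`: the sum over the first
arrivals `γ` at `v` through `w` of `weight γ · F_{Λ∖γ}({w,v}; {v,w₀})` is the sum of the weights
of the walks `ω : a → {v, w₀}` of `Λ` that either avoid `v` with `w = w₀` (trivial continuation)
or pass `w` right before `v` — gluing is a weight-multiplicative bijection. -/
theorem port_sum (hv : v ∈ Λ) (hva : v ∉ a) (hvw : hexGraph.Adj v w) (x σ : ℝ) :
    (∑ γ : HexMidEdgeSAW Λ a s(v, w), if v ∉ γ.verts then
        γ.weight x σ * hexParafermionicObservable (Λ \ γ.verts.toFinset) s(w, v) x σ s(v, w₀)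
      else 0) =
      ∑ ω : HexMidEdgeSAW Λ a s(v, w₀),
        if (v ∉ ω.verts ∧ w = w₀) ∨ [w, v] <:+: ω.verts then ω.weight x σ else 0 := by
  classical
  -- the gluing map, from (first arrival, continuation) pairs to walks
  let S := Σ γ : {γ : HexMidEdgeSAW Λ a s(v, w) // v ∉ γ.verts},
    HexMidEdgeSAW (Λ \ γ.1.verts.toFinset) s(w, v) s(v, w₀)
  let T := {ω : HexMidEdgeSAW Λ a s(v, w₀) // (v ∉ ω.verts ∧ w = w₀) ∨ [w, v] <:+: ω.verts}
  let glue : S → HexMidEdgeSAW Λ a s(v, w₀) := fun p =>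
    ⟨p.1.1.verts ++ p.2.verts, glue_subset p.1.1 p.2, glue_nodup p.1.1 p.2,
      glue_isChain p.1.1 hva p.1.2 hvw p.2, glue_head_mem p.1.1 hva p.2,
      glue_getLast_mem p.1.1 hva p.1.2 hvw p.2, fun h => absurd h (glue_ne_nil p.1.1 hva p.2),
      fun _ => glue_edges_nodup p.1.1 hva p.1.2 hvw p.2, p.1.1.fst_mem⟩
  let Φ : S → T := fun p => ⟨glue p, spec_of_verts_eq_append p.1.1 hva p.1.2 hvw p.2 _ rfl⟩
  have hΦ : Function.Bijective Φ := by
    constructor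
    · rintro ⟨⟨γ, hvγ⟩, η⟩ ⟨⟨γ', hvγ'⟩, η'⟩ h
      have hverts : γ.verts ++ η.verts = γ'.verts ++ η'.verts :=
        congrArg (fun ω : T => ω.1.verts) h
      have hγ : γ = γ' := HexMidEdgeSAW.ext (by
        rw [← takeWhile_glue γ hva hvγ η, ← takeWhile_glue γ' hva hvγ' η', hverts])
      subst hγ
      have hη : η = η' := HexMidEdgeSAW.ext (List.append_cancel_left hverts)
      subst hη
      rfl
    · rintro ⟨ω, ⟨hvω, hw⟩ | hω⟩
      · subst hw
        obtain ⟨η₀, hη₀⟩ := exists_trivCont ω hv hvω hvw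
        refine ⟨⟨⟨ω, hvω⟩, η₀⟩, Subtype.ext (HexMidEdgeSAW.ext ?_)⟩
        show ω.verts ++ η₀.verts = ω.verts
        rw [hη₀, List.append_nil]
      · obtain ⟨γ, hvγ, η, h⟩ := exists_cut hv hvw ω hω
        exact ⟨⟨⟨γ, hvγ⟩, η⟩, Subtype.ext (HexMidEdgeSAW.ext h.symm)⟩
  rw [← WalledPorts.sum_subtype_eq_sum_ite (fun γ : HexMidEdgeSAW Λ a s(v, w) => v ∉ γ.verts)
      (fun γ => γ.weight x σ *
        hexParafermionicObservable (Λ \ γ.verts.toFinset) s(w, v) x σ s(v, w₀)),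
    ← WalledPorts.sum_subtype_eq_sum_ite (fun ω : HexMidEdgeSAW Λ a s(v, w₀) =>
      (v ∉ ω.verts ∧ w = w₀) ∨ [w, v] <:+: ω.verts) (fun ω => ω.weight x σ)]
  simp only [hexParafermionicObservable_def, Finset.mul_sum]
  have hS : (∑ p : S, p.1.1.weight x σ * p.2.weight x σ) =
      ∑ γ : {γ : HexMidEdgeSAW Λ a s(v, w) // v ∉ γ.verts},
        ∑ η : HexMidEdgeSAW (Λ \ γ.1.verts.toFinset) s(w, v) s(v, w₀),
          γ.1.weight x σ * η.weight x σ :=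
    Fintype.sum_sigma _
  rw [← hS]
  exact Fintype.sum_bijective Φ hΦ _ _ fun p =>
    (weight_eq_of_verts_eq_append p.1.1 hva p.1.2 hvw p.2 (glue p) rfl x σ).symm

/-- **Partition by the port of first arrival.** For pairwise distinct neighbours `w₀, w₁, w₂`
of `v` and a walk `ω : a → {v, w₀}` (`a ∌ v`), exactly one of the three conditions "`ω` avoids
`v` and `w_j = w₀`, or passes `w_j` right before `v`" (`j = 0, 1, 2`) holds: a walk avoiding `v`
satisfies only the first; a walk through `v` enters `v` from a unique neighbour. -/
theorem eq_ite_add_ite_add_ite (hva : v ∉ a) (h₀ : hexGraph.Adj v w₀) (h₁ : hexGraph.Adj v w₁)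
    (h₂ : hexGraph.Adj v w₂) (h₀₁ : w₀ ≠ w₁) (h₁₂ : w₁ ≠ w₂) (h₀₂ : w₀ ≠ w₂)
    (ω : HexMidEdgeSAW Λ a s(v, w₀)) (c : ℂ)
    [Decidable ((v ∉ ω.verts ∧ w₀ = w₀) ∨ [w₀, v] <:+: ω.verts)]
    [Decidable ((v ∉ ω.verts ∧ w₁ = w₀) ∨ [w₁, v] <:+: ω.verts)]
    [Decidable ((v ∉ ω.verts ∧ w₂ = w₀) ∨ [w₂, v] <:+: ω.verts)] :
    c = (if (v ∉ ω.verts ∧ w₀ = w₀) ∨ [w₀, v] <:+: ω.verts then c else 0) +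
        (if (v ∉ ω.verts ∧ w₁ = w₀) ∨ [w₁, v] <:+: ω.verts then c else 0) +
        (if (v ∉ ω.verts ∧ w₂ = w₀) ∨ [w₂, v] <:+: ω.verts then c else 0) := by
  by_cases hvω : v ∈ ω.verts
  · obtain ⟨p, hvp, hp⟩ := exists_infix_of_mem hva ω hvω
    have key : ∀ u, ((v ∉ ω.verts ∧ u = w₀) ∨ [u, v] <:+: ω.verts) ↔ u = p := fun u =>
      ⟨fun h => h.elim (fun h => absurd hvω h.1) fun h => eq_of_infix_of_infix ω.nodup h hp,
        fun h => Or.inr (h ▸ hp)⟩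
    rcases SourceLoopBound.eq_or_eq_or_eq_of_adj h₀ h₁ h₂ h₀₁ h₀₂ h₁₂ hvp with h | h | h
    · rw [if_pos ((key w₀).2 h.symm), if_neg fun h' => h₀₁ (((key w₁).1 h').trans h).symm,
        if_neg fun h' => h₀₂ (((key w₂).1 h').trans h).symm]
      ring
    · rw [if_neg fun h' => h₀₁ (((key w₀).1 h').trans h), if_pos ((key w₁).2 h.symm),
        if_neg fun h' => h₁₂ (((key w₂).1 h').trans h).symm]
      ring
    · rw [if_neg fun h' => h₀₂ (((key w₀).1 h').trans h),
        if_neg fun h' => h₁₂ (((key w₁).1 h').trans h), if_pos ((key w₂).2 h.symm)]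
      ring
  · have hn : ∀ u, u ≠ w₀ → ¬ ((v ∉ ω.verts ∧ u = w₀) ∨ [u, v] <:+: ω.verts) := fun u hu h =>
      h.elim (fun h => hu h.2) fun h => hvω (h.subset (by simp))
    rw [if_pos (Or.inl ⟨hvω, rfl⟩), if_neg (hn w₁ h₀₁.symm), if_neg (hn w₂ h₀₂.symm)]
    ring

end PortRenewal

/-- **Port renewal at a vertex off the source** (stub `stub_portRenewal` of the line
`Ideator3Sketch` for the crux `NoFoldBound`). For `v ∈ Λ`, `v ∉ a`, with neighbours
`w₀, w₁, w₂`: a walk from `a` to `{v, w₀}` either avoids `v` — it is then a first arrival at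
`v` through `w₀` followed by the trivial walk of the slit domain — or first reaches `v` from a
port `w_j` (a walk `γ` to `{v, w_j}` avoiding `v`) and continues as a walk of the SLIT DOMAIN
`Λ ∖ γ` from the door `{w_j, v}` to `{v, w₀}`; weights multiply (the two polylines meet
collinearly at `mid{w_j, v}`). Valid for all real `x, σ`, without simple connectivity. -/
theorem stub_portRenewal :
    ∀ (Λ : Finset HexVertex) (a : Sym2 HexVertex) (v w₀ w₁ w₂ : HexVertex), v ∈ Λ → v ∉ a →
      hexGraph.Adj v w₀ → hexGraph.Adj v w₁ → hexGraph.Adj v w₂ → w₀ ≠ w₁ → w₁ ≠ w₂ → w₀ ≠ w₂ →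
      ∀ (x σ : ℝ),
        hexParafermionicObservable Λ a x σ s(v, w₀) =
          (∑ γ : HexMidEdgeSAW Λ a s(v, w₀), if v ∉ γ.verts then
              γ.weight x σ * hexParafermionicObservable (Λ \ γ.verts.toFinset) s(w₀, v) x σ s(v, w₀)
            else 0) +
          (∑ γ : HexMidEdgeSAW Λ a s(v, w₁), if v ∉ γ.verts then
              γ.weight x σ * hexParafermionicObservable (Λ \ γ.verts.toFinset) s(w₁, v) x σ s(v, w₀)
            else 0) +
          (∑ γ : HexMidEdgeSAW Λ a s(v, w₂), if v ∉ γ.verts then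
              γ.weight x σ * hexParafermionicObservable (Λ \ γ.verts.toFinset) s(w₂, v) x σ s(v, w₀)
            else 0) := by
  intro Λ a v w₀ w₁ w₂ hv hva h₀ h₁ h₂ h₀₁ h₁₂ h₀₂ x σ
  rw [PortRenewal.port_sum hv hva h₀ x σ, PortRenewal.port_sum hv hva h₁ x σ,
    PortRenewal.port_sum hv hva h₂ x σ, ← Finset.sum_add_distrib, ← Finset.sum_add_distrib,
    hexParafermionicObservable_def]
  exact Finset.sum_congr rfl fun ω _ =>
    PortRenewal.eq_ite_add_ite_add_ite hva h₀ h₁ h₂ h₀₁ h₁₂ h₀₂ ω (ω.weight x σ)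


end Summit.CriticalPhenomena.SAWScalingLimit.Theorems.SAWDevelopingMapNoFoldBound

end
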